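import Summits.ABC.ABC.Theorems.FeketeScalesTargetOfSubPowerSlack

/-!
# Route FeketeScales — crux `Target` (stmt-ABC-2159): calibration of the sub-power window

Calibration for every line of `Cruxes/Target/` (all lines pass through the pointwise
sub-power slack `∃ τ < 1, ∃ A, c < rad · exp(A (log rad)^τ)`, cf. `Target.target_of_subPowerSlack`):

* `Target.subPowerSlack_of_polyConstant` — LEGENDRE DUALITY between the constant of abc and the slack
  of the crux: abc with a quasi-polynomial constant, `c ≤ exp(A ε^{-κ}) rad^{1+ε}` for all `0 < ε ≤ 1`,
  gives the sub-power slack with `τ = κ⁺/(κ⁺+1) < 1` (optimise `ε = (log rad)^{-1/(κ⁺+1)}` per triple);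
  hence `Target.target_of_polyConstant`: abc with `C(ε) = exp(O(ε^{-κ}))` for SOME `κ` implies `Target`.
* (Recorded, not landed here: the FLOOR of the window — no sub-power slack with exponent `τ < 1/2`
  holds for all abc triples, by Stewart–Tijdeman (`Literature.Barriers.ABC.EpsilonCannotBeDropped_holds`);
  kernel-checked as `not_subPowerSlack_of_lt_half` in the crux workfile `Cruxes/Target/SketchIdeator2.lean`.
  So every skeleton of this crux lives in `τ ∈ [1/2, 1)`; `τ = 1/2` is the Robert–Stewart–Tenenbaum
  scale, cf. `Target.target_of_rstConjectureAUpper` in `FeketeScalesTargetOfRST.lean`.)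

Proofs adapted from `Cruxes/Target/SketchIdeator2.lean` (planner-cruxidea-stmt-ABC-2159-2-0).
`--supports stmt-ABC-2159`; closes nothing.
-/

-- `Summit.<Summit>.<Problem>` is the mandated summit-side namespace (CONVENTIONS §2); for the
-- single-conjunct summit `ABC` the two coincide, so the duplicate `ABC.ABC` is deliberate.
set_option linter.dupNamespace false

namespace Summit.ABC.ABC.Theorems

open Literature.NumberTheory.DiophantineGeometry
open Summit.ABC.ABC.Theses.FeketeScales

/-- **Legendre duality (constant ↔ slack).**  abc with a quasi-polynomial constant —
`∃ κ A, ∀ 0 < ε ≤ 1, ∀ abc triples, c ≤ exp(A ε^{-κ}) · rad^{1+ε}` — implies the pointwise sub-power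
slack `∃ τ < 1, ∃ A', c < rad · exp(A' (log rad)^τ)`, with `τ = κ⁺/(κ⁺+1)`: for `L = log rad ≥ 1` take
`ε = L^{-1/(κ⁺+1)}`, so that `ε^{-κ⁺} = ε L = L^τ`; for `L < 1` take `ε = 1`. [folklore] -/
theorem Target.subPowerSlack_of_polyConstant
    (h : ∃ κ A : ℝ, ∀ ε : ℝ, 0 < ε → ε ≤ 1 → ∀ a b c : ℕ, IsABCTriple a b c →
      (c : ℝ) ≤ Real.exp (A * ε ^ (-κ)) * ((rad a b c : ℕ) : ℝ) ^ (1 + ε)) :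
    ∃ τ : ℝ, τ < 1 ∧ ∃ A : ℝ, ∀ a b c : ℕ, IsABCTriple a b c →
      (c : ℝ) < ((rad a b c : ℕ) : ℝ) * Real.exp (A * Real.log ((rad a b c : ℕ) : ℝ) ^ τ) := by
  obtain ⟨κ, A, h⟩ := h
  -- normalise the exponent and the constant: `k := max κ 0 ≥ 0`, `B := |A| ≥ 0`
  set k : ℝ := max κ 0 with hk
  have hk0 : 0 ≤ k := le_max_right _ _
  have hκk : κ ≤ k := le_max_left _ _
  set B : ℝ := |A| with hB
  have hB0 : 0 ≤ B := abs_nonneg A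
  -- pointwise: for `0 < ε ≤ 1`, `log c ≤ B ε^{-k} + (1+ε) log rad`
  have key : ∀ ε : ℝ, 0 < ε → ε ≤ 1 → ∀ a b c : ℕ, IsABCTriple a b c →
      Real.log (c : ℝ) ≤ B * ε ^ (-k) + (1 + ε) * Real.log ((rad a b c : ℕ) : ℝ) := by
    intro ε hε hε1 a b c habc
    have hc0 : (0 : ℝ) < (c : ℝ) := by
      obtain ⟨ha, hb, habc', -⟩ := habc; exact_mod_cast (show 0 < c by omega)
    have hrad2 : (2 : ℝ) ≤ ((rad a b c : ℕ) : ℝ) := by exact_mod_cast SubmultOfRST.two_le_rad habc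
    have hrad0 : (0 : ℝ) < ((rad a b c : ℕ) : ℝ) := by linarith
    have h1 := h ε hε hε1 a b c habc
    have h2 : Real.log (c : ℝ)
        ≤ Real.log (Real.exp (A * ε ^ (-κ)) * ((rad a b c : ℕ) : ℝ) ^ (1 + ε)) :=
      Real.log_le_log hc0 h1
    rw [Real.log_mul (Real.exp_pos _).ne' (Real.rpow_pos_of_pos hrad0 _).ne', Real.log_exp,
      Real.log_rpow hrad0] at h2
    have hεk : ε ^ (-κ) ≤ ε ^ (-k) := Real.rpow_le_rpow_of_exponent_ge hε hε1 (by linarith)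
    have hεκ0 : 0 ≤ ε ^ (-κ) := Real.rpow_nonneg hε.le _
    have hAB : A * ε ^ (-κ) ≤ B * ε ^ (-k) :=
      calc A * ε ^ (-κ) ≤ |A| * ε ^ (-κ) := mul_le_mul_of_nonneg_right (le_abs_self A) hεκ0
        _ ≤ |A| * ε ^ (-k) := mul_le_mul_of_nonneg_left hεk (abs_nonneg A)
    linarith
  -- the exponent `τ := k/(k+1) ∈ [0,1)`
  have hk1 : 0 < k + 1 := by linarith
  set τ : ℝ := k / (k + 1) with hτ
  have hτ1 : τ < 1 := by rw [hτ, div_lt_one hk1]; linarith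
  have hτ0 : 0 ≤ τ := div_nonneg hk0 hk1.le
  have hlog2 : 0 < Real.log 2 := Real.log_pos one_lt_two
  have hl2τ : 0 < Real.log 2 ^ τ := Real.rpow_pos_of_pos hlog2 _
  set A' : ℝ := (B + 2) / Real.log 2 ^ τ + (B + 1) + 1 with hA'
  have hA'1 : 0 ≤ (B + 2) / Real.log 2 ^ τ := div_nonneg (by linarith) hl2τ.le
  refine ⟨τ, hτ1, A', ?_⟩
  intro a b c habc
  have hc0 : (0 : ℝ) < (c : ℝ) := by
    obtain ⟨ha, hb, habc', -⟩ := habc; exact_mod_cast (show 0 < c by omega)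
  have hrad2 : (2 : ℝ) ≤ ((rad a b c : ℕ) : ℝ) := by exact_mod_cast SubmultOfRST.two_le_rad habc
  have hrad0 : (0 : ℝ) < ((rad a b c : ℕ) : ℝ) := by linarith
  set L : ℝ := Real.log ((rad a b c : ℕ) : ℝ) with hL
  have hL2 : Real.log 2 ≤ L := Real.log_le_log two_pos hrad2
  have hL0 : 0 < L := hlog2.trans_le hL2
  have hLτ0 : 0 < L ^ τ := Real.rpow_pos_of_pos hL0 _
  have hLτ2 : Real.log 2 ^ τ ≤ L ^ τ := Real.rpow_le_rpow hlog2.le hL2 hτ0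
  -- main claim: `log c ≤ L + (A' - 1) L^τ`
  have main : Real.log (c : ℝ) ≤ L + (A' - 1) * L ^ τ := by
    rcases le_or_gt 1 L with hL1 | hL1
    · -- `L ≥ 1`: take `ε := L^{-1/(k+1)}`, so that `ε^{-k} = ε L = L^τ`
      set ε : ℝ := L ^ (-(1 / (k + 1))) with hε
      have hε0 : 0 < ε := Real.rpow_pos_of_pos hL0 _
      have hexpneg : -(1 / (k + 1)) ≤ 0 := by
        have : 0 < 1 / (k + 1) := by positivity
        linarith
      have hε1 : ε ≤ 1 := Real.rpow_le_one_of_one_le_of_nonpos hL1 hexpneg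
      have hk' := key ε hε0 hε1 a b c habc
      have hεk : ε ^ (-k) = L ^ τ := by
        rw [hε, ← Real.rpow_mul hL0.le]
        congr 1
        rw [hτ]; field_simp
      have hεL : ε * L = L ^ τ := by
        have e1 : ε * L = L ^ (-(1 / (k + 1)) + 1) := by
          rw [Real.rpow_add hL0, Real.rpow_one]
        rw [e1]; congr 1; rw [hτ]; field_simp; ring
      have e2 : B * ε ^ (-k) + (1 + ε) * L = L + (B + 1) * L ^ τ := by
        rw [hεk, add_mul, one_mul, hεL]; ring
      rw [e2] at hk'
      have hcoef : (B + 1) * L ^ τ ≤ (A' - 1) * L ^ τ := by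
        apply mul_le_mul_of_nonneg_right _ hLτ0.le
        rw [hA']; linarith
      linarith
    · -- `L < 1`: take `ε := 1`
      have hk' := key 1 one_pos le_rfl a b c habc
      rw [Real.one_rpow, mul_one] at hk'
      have h3 : B + 2 ≤ (B + 2) / Real.log 2 ^ τ * L ^ τ := by
        rw [div_mul_eq_mul_div, le_div_iff₀ hl2τ]
        exact mul_le_mul_of_nonneg_left hLτ2 (by linarith)
      have h4 : (B + 2) / Real.log 2 ^ τ * L ^ τ ≤ (A' - 1) * L ^ τ := by
        apply mul_le_mul_of_nonneg_right _ hLτ0.le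
        rw [hA']; linarith
      linarith
  -- exponentiate: `c ≤ rad · exp((A'-1) L^τ) < rad · exp(A' L^τ)`
  have hexp : (c : ℝ) ≤ ((rad a b c : ℕ) : ℝ) * Real.exp ((A' - 1) * L ^ τ) := by
    calc (c : ℝ) = Real.exp (Real.log (c : ℝ)) := (Real.exp_log hc0).symm
      _ ≤ Real.exp (L + (A' - 1) * L ^ τ) := Real.exp_le_exp.mpr main
      _ = ((rad a b c : ℕ) : ℝ) * Real.exp ((A' - 1) * L ^ τ) := by
          rw [Real.exp_add, hL, Real.exp_log hrad0]
  have hlt : Real.exp ((A' - 1) * L ^ τ) < Real.exp (A' * L ^ τ) := by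
    apply Real.exp_lt_exp.mpr; nlinarith
  calc (c : ℝ) ≤ ((rad a b c : ℕ) : ℝ) * Real.exp ((A' - 1) * L ^ τ) := hexp
    _ < ((rad a b c : ℕ) : ℝ) * Real.exp (A' * L ^ τ) := mul_lt_mul_of_pos_left hlt hrad0

/-- **abc with a quasi-polynomial constant gives the crux `Target`** (stmt-ABC-2159): by Legendre
duality (`Target.subPowerSlack_of_polyConstant`) and `Target.target_of_subPowerSlack`.  The hypothesis
is conjecture-grade (it implies `ABC`); it is taken as a hypothesis. [folklore] -/
theorem Target.target_of_polyConstant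
    (h : ∃ κ A : ℝ, ∀ ε : ℝ, 0 < ε → ε ≤ 1 → ∀ a b c : ℕ, IsABCTriple a b c →
      (c : ℝ) ≤ Real.exp (A * ε ^ (-κ)) * ((rad a b c : ℕ) : ℝ) ^ (1 + ε)) :
    Target :=
  Target.target_of_subPowerSlack (Target.subPowerSlack_of_polyConstant h)

end Summit.ABC.ABC.Theorems
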